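import Literature.MathematicalPhysics.QuantumFieldTheory.Balaban1983to89.B9
import Literature.MathematicalPhysics.QuantumFieldTheory.Balaban1983to89.QGQInverse
import Literature.MathematicalPhysics.QuantumFieldTheory.Balaban1983to89.B6Cor28

/-!
# `Balaban1983to89.B9Eq3132Whole` — [B9] (3.132) p. 422 AS THE WHOLE PRINTED LEAF `B9.Stmt3132Printed`: a glue module over the
# cell's Combes–Thomas mechanism `QGQInverse.inverse_decay` BY NAME, with the un-normalising bookkeeping that module leaves open
# (weights, scale transfer from [4] (2.60)) and the printed quantifier prefix of Theorem 3.12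

T. Bałaban, *Propagators for lattice gauge theories in a background field*, Commun. Math. Phys. **99** (1985) 389–434
[`Balaban1985BackgroundPropagators`, "B9"]; [4] = T. Bałaban, *Propagators and renormalization transformations for lattice
gauge theories. II*, Commun. Math. Phys. **96** (1984) 223–250 [`Balaban1984PropagatorsII`].

statement-level skeleton of published theorems with citation tags; proofs where landed; nothing here is a claim about the
Yang–Mills mass gap

THE PRINTED LOCUS (verbatim, p. 422 [PDF 34], before Theorem 3.12).  *"The operators (QGQ\*)^{−1}, or (QG₁Q\*)^{−1}, can be
analyzed in the same way as the operator (Q′G′²Q′\*)^{−1}. We will not repeat these considerations here, let us write only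
bounds. We have |(QGQ\*)^{−1}(y, y′)| ≤ O(1)(L^jη)^{−2}(L^{j′}η)^{−d}e^{−δ₁d(y,y′)} for y ∈ Λ_j, y′ ∈ Λ_{j′}, (3.132) and the same for
the operator with G₁ instead of G."*  Cell census: GAPS G-B9-15 («by analogy; δ₁ first appears here»).

THE POINT.  The cell's typed skeleton `…Balaban1983to89.B9` carries (3.132) as the family leaf `B9.Stmt3132Printed d c35 geo bg
QGQinv QG₁Qinv` (under Theorem-3.12-type thresholds — M ≧ M₄, Mα₀ ≦ a₀, (3.35) AND (3.36) — the bound `B9.Ineq3132` for both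
kernels with one O(1) and one δ₁), consumed by `DagBinding.B9LeafX` ∕ `B9LeafKnit.b9LeafX_of_leaves` as the hypothesis `s3132`; no
theorem concluded it (N06 ASSIGNMENT row 26, «free»).  The print gives no proof («the same way as (Q′G′²Q′\*)^{−1}»); the cell's
reader unit r1 wrote a repair (`HOME/b2b-balaban-r1/QGQ-inverse-proof.md`) whose MECHANISM is kernel-checked in
`…Balaban1983to89.QGQInverse`: coercivity of the normalised matrix S̃ = D^{−1}W^{1/2}(QGQ\*)W^{1/2}D^{−1} plus exponentially weighted
off-diagonal row∕column sums below the coercivity constant give `|S̃⁻¹(y, y′)| ≦ (γ − ρ)⁻¹e^{−κd(y,y′)}`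
(`QGQInverse.inverse_decay`, finite Combes–Thomas); its docstring records what it does NOT certify — the two analytic inputs
(II.a coercivity, II.b the weighted sums from Thm 3.3 + [4] Lemma 2.1) and *"the multiscale normalisation bookkeeping ([4]
Lemma 2.1 (2.60)–(2.61))"*, i.e. un-normalising S̃⁻¹ into the (3.132) shape.  THIS FILE is the glue from that mechanism to
the leaf, with the un-normalising bookkeeping certified:

* §1 the inputs as schemas — `InvNormalised K S w` (the kernel `K.ker U` of (QGQ\*)^{−1} w.r.t. the coarse measure is read off
  the inverse of the normalised matrix `S U` with site weights w: |K(U)(y, y′)| ≦ w(y)w(y′)|(S U)⁻¹(y, y′)| — the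
  dictionary «K = N S̃⁻¹ N, N = diag w» entrywise); `WeightsTransfer g d w ε A` (the weights un-normalise into the printed powers
  at the price of a growth factor: w(y)w(y′) ≦ A e^{εd(y,y′)}(L^jη)^{−2}(L^{j′}η)^{−d} — for the symmetric normalisation
  w = (L^jη)^{−(1+d∕2)} this IS the scale transfer of [4] (2.60) with A = L^{|d−2|∕2}, `weightsTransfer_symm_of_260`); `CTInputs c35
  geo bg S` (II.a + II.b under the printed prefix of Theorem 3.12: ∃ M₄ a₀ γ ρ κ with ρ < γ, κ > 0 such that for M ≧ M₄, 0 < α₀,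
  Mα₀ ≦ a₀, U in (3.35) ∩ (3.36): `QGQInverse.Coercive (S i U) γ` and the e^{κd}−1-weighted row and column sums of `S i U` are ≦ ρ).
* §2 `ineq3132_of_coercive` — ONE member, ONE U: from the Combes–Thomas data, the dictionary and the weights transfer at a rate
  ε ≦ κ, the tree's display `B9.Ineq3132 d K ((γ − ρ)⁻¹A) (κ − ε) U`, by `QGQInverse.inverse_decay` BY NAME (d a pseudo-metric,
  L^jη ≧ 0).  `ineq3132_mono`: «of course with different constants».
* §3 ★ `stmt3132Printed_of_coercive` — **THE WHOLE PRINTED LEAF** `B9.Stmt3132Printed d c35 geo bg QGQinv QG₁Qinv` from `CTInputs`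
  for the two normalised matrices (of QGQ\* and of QG₁Q\*), `InvNormalised` for the two kernels, the weights transfer at every
  rate under an M-threshold with one A > 0 (as (2.60) supplies for a common L), and the pseudo-metric ∕ sign facts; the
  printed quantifiers are met with M₄′ := max(max M₄ M₄′, M_w(½κ₀)), κ₀ := min κ κ′, a₀′ := min a₀ a₀′, the rate δ₁ := ½κ₀ and
  O(1) := ((γ − ρ)⁻¹ + (γ′ − ρ′)⁻¹)·A.

HONEST SCOPE.  Nothing of print is asserted and print's own route («the same way as (Q′G′²Q′\*)^{−1}», i.e. a Theorem-3.9-type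
random-walk expansion) is NOT typed here; this module formalises the cell's written Combes–Thomas repair route AS HYPOTHESES
OF LOCATED SHAPE (II.a, II.b, the normalisation dictionary) plus kernel-checked bookkeeping, exactly the part
`QGQInverse`'s docstring names as missing.  Value: the leaf inhabited over named inputs with explicit thresholds, rate and
O(1) — NOT a node discharge, NOT summit progress; one finite lattice programme; nothing continuum, nothing about the mass gap.
Cell `pub-ymgap` (HUMAN RULING D-0062), Track A node N06 [B9], N06-ASSIGNMENT v1 row 26 (bundle F4), seat `pub-ymgap-dag-n06-i`,
2026-08-26.
-/

namespace Literature.MathematicalPhysics.QuantumFieldTheory.Balaban1983to89.B9Eq3132Whole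

open Literature.MathematicalPhysics.QuantumFieldTheory.Balaban1983to89
open QGQInverse B6Cor28

noncomputable section

/-! ## §1 The inputs as schemas -/

section OneMember

variable {g : B9.Geometry} {B : B9.Backgrounds}

/-- **THE UN-NORMALISING DICTIONARY** (located hypothesis shape; the written repair's S̃ = D^{−1}W^{1/2}(QGQ\*)W^{1/2}D^{−1} read
entrywise on the inverse): the kernel `K.ker U (y, y′)` of (QGQ\*)^{−1} (or (QG₁Q\*)^{−1}) with respect to the coarse measure on 𝔅 is
dominated by w(y)·w(y′)·|(S U)⁻¹(y, y′)| for the normalised matrix `S U` on 𝔅 × 𝔅 and site weights w (N = diag w,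
K = N S̃⁻¹ N up to the measure normalisation).  Nothing of print; the dictionary between the operator and a finite matrix.
[cite: Balaban1985BackgroundPropagators, (3.132) p.422 + (3.126) p.420 (the operator (QGQ\*)^{−1}; dictionary shape)] -/
def InvNormalised [Fintype g.Site] [DecidableEq g.Site] (K : B9.SiteKernel g B) (S : B.Cfg → Matrix g.Site g.Site ℝ)
    (w : g.Site → ℝ) : Prop :=
  ∀ (U : B.Cfg) (y y' : g.Site), |K.ker U y y'| ≤ w y * w y' * |(S U)⁻¹ y y'|

/-- **THE WEIGHTS UN-NORMALISE INTO THE PRINTED POWERS** at the price of an exponential growth factor of rate ε: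
w(y)w(y′) ≦ A·e^{εd(y,y′)}·(L^jη)^{−2}(L^{j′}η)^{−d} — the shape [4] Lemma 2.1 (2.60) delivers for power weights (a power of the scale
at one end of a pair moves to the other end with constant L^{|q|} and growth e^{εd}, `B6Cor28.transfer_of_260`; for the symmetric
weights w = (L^jη)^{−(1+d∕2)} see `weightsTransfer_symm_of_260`).  Hypothesis shape.
[cite: Balaban1984PropagatorsII, Lemma 2.1 (2.60) p.234; Balaban1985BackgroundPropagators, (3.132) p.422 (the powers)] -/
def WeightsTransfer (g : B9.Geometry) (d : ℕ) (w : g.Site → ℝ) (ε A : ℝ) : Prop :=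
  ∀ y y' : g.Site, w y * w y' ≤ A * Real.exp (ε * g.dist y y') * g.len y ^ (-(2 : ℝ)) * g.len y' ^ (-(d : ℝ))

end OneMember

section FamilySchemas

variable {I : Type}

/-- **THE TWO ANALYTIC INPUTS OF THE COMBES–THOMAS ROUTE UNDER THE PRINTED PREFIX OF THEOREM 3.12** (p. 423: *"If an external gauge
field configuration U satisfies both regularity conditions (3.35), (3.36) for α₀ sufficiently small"*; «M sufficiently large»
inherited, GAPS G-B9-16): there are M₄, a₀ > 0, a coercivity constant γ, a bound ρ < γ and a rate κ > 0 such that for every member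
with M ≧ M₄, every 0 < α₀ with Mα₀ ≦ a₀ and every U in the classes (3.35) and (3.36), the normalised matrix `S i U` is COERCIVE with γ
(`QGQInverse.Coercive` — II.a of the written repair: from Theorem 3.11-type positivity by the variational device
`QGQInverse.qgq_coercive_of_approx_right_inverse`) and its (e^{κd} − 1)-weighted absolute ROW and COLUMN sums are ≦ ρ (II.b: from
Theorem 3.3's decay of QGQ\* + [4] Lemma 2.1 (2.61)).  HYPOTHESIS SCHEMA — neither input is in the tree.
[cite: Balaban1985BackgroundPropagators, (3.132) p.422 + Thm 3.12 p.423 (prefix) + Thm 3.11 p.416 + Thm 3.3 p.399; Balaban1984PropagatorsII, Lemma 2.1 (2.61) p.234] -/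
def CTInputs (c35 : ℝ) (geo : I → B9.Geometry) (bg : I → B9.Backgrounds) [∀ i, Fintype (geo i).Site]
    (S : ∀ i, (bg i).Cfg → Matrix (geo i).Site (geo i).Site ℝ) : Prop :=
  ∃ M₄ a₀ γ ρ κ : ℝ, 0 < M₄ ∧ 0 < a₀ ∧ ρ < γ ∧ 0 < κ ∧
    ∀ i : I, M₄ ≤ (geo i).M → ∀ α₀ : ℝ, 0 < α₀ → (geo i).M * α₀ ≤ a₀ →
      ∀ U : (bg i).Cfg, (bg i).Reg335 c35 α₀ U → (bg i).Reg336 c35 α₀ U →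
        Coercive (S i U) γ ∧
          (∀ y : (geo i).Site, ∑ y' : (geo i).Site, |S i U y y'| * (Real.exp (κ * (geo i).dist y y') - 1) ≤ ρ) ∧
          (∀ y' : (geo i).Site, ∑ y : (geo i).Site, |S i U y y'| * (Real.exp (κ * (geo i).dist y y') - 1) ≤ ρ)

end FamilySchemas

/-! ## §2 (3.132) at one member and one configuration, from the Combes–Thomas data -/

section OneU

variable {g : B9.Geometry} {B : B9.Backgrounds} [Fintype g.Site] [DecidableEq g.Site]

omit [Fintype g.Site] [DecidableEq g.Site] in
/-- Exponential bookkeeping: a growth factor of rate ε against a decay of rate κ leaves the decay rate κ − ε.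
[cite: Balaban1984PropagatorsII, Lemma 2.1 (2.60) p.234 (bookkeeping: absorption of the transfer growth)] -/
theorem exp_growth_mul_decay (ε κ t : ℝ) :
    Real.exp (ε * t) * Real.exp (-(κ * t)) = Real.exp (-((κ - ε) * t)) := by
  rw [← Real.exp_add]
  ring_nf

/-- **(3.132) AT ONE CONFIGURATION FROM THE COMBES–THOMAS DATA** — `QGQInverse.inverse_decay` BY NAME, un-normalised.  At a member
whose multiscale distance is a pseudo-metric (symmetric, zero diagonal, (2.54)) with L^jη ≧ 0: if the normalised matrix S of
(QGQ\*)(U) is coercive with γ and has (e^{κd} − 1)-weighted absolute row∕column sums ≦ ρ < γ (κ ≧ 0), the kernel K(U) is read off S⁻¹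
with weights w (`|K(U)(y,y′)| ≦ w(y)w(y′)|S⁻¹(y,y′)|`), and the weights un-normalise with growth rate ε and constant
A ≧ 0 (`WeightsTransfer`), then the tree's display holds: `B9.Ineq3132 d K ((γ − ρ)⁻¹·A) (κ − ε) U`, i.e.
|K(U)(y, y′)| ≦ (γ − ρ)⁻¹A·(L^jη)^{−2}(L^{j′}η)^{−d}e^{−(κ−ε)d(y,y′)}.
[cite: Balaban1985BackgroundPropagators, (3.132) p.422; Balaban1984PropagatorsII, Lemma 2.1 (2.60) p.234] -/
theorem ineq3132_of_coercive (d : ℕ) (K : B9.SiteKernel g B) (U : B.Cfg) (S : Matrix g.Site g.Site ℝ) (w : g.Site → ℝ)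
    {γ κ ρ ε A : ℝ} (hργ : ρ < γ) (hκ : 0 ≤ κ) (hA : 0 ≤ A) (hS : Coercive S γ)
    (hsymm : ∀ y y' : g.Site, g.dist y y' = g.dist y' y) (hzero : ∀ y : g.Site, g.dist y y = 0)
    (htri : ∀ a b c : g.Site, g.dist a c ≤ g.dist a b + g.dist b c) (hlen : ∀ y : g.Site, 0 ≤ g.len y)
    (hrow : ∀ y : g.Site, ∑ y' : g.Site, |S y y'| * (Real.exp (κ * g.dist y y') - 1) ≤ ρ)
    (hcol : ∀ y' : g.Site, ∑ y : g.Site, |S y y'| * (Real.exp (κ * g.dist y y') - 1) ≤ ρ)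
    (hK : ∀ y y' : g.Site, |K.ker U y y'| ≤ w y * w y' * |S⁻¹ y y'|)
    (hwt : WeightsTransfer g d w ε A) :
    B9.Ineq3132 d K ((γ - ρ)⁻¹ * A) (κ - ε) U := by
  intro y y'
  have hinv := inverse_decay S g.dist hργ hκ hS hsymm hzero htri hrow hcol y y'
  have hγρ : 0 ≤ (γ - ρ)⁻¹ := inv_nonneg.mpr (by linarith)
  have hrhs : 0 ≤ A * Real.exp (ε * g.dist y y') * g.len y ^ (-(2 : ℝ)) * g.len y' ^ (-(d : ℝ)) :=
    mul_nonneg (mul_nonneg (mul_nonneg hA (Real.exp_nonneg _)) (Real.rpow_nonneg (hlen y) _))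
      (Real.rpow_nonneg (hlen y') _)
  calc |K.ker U y y'| ≤ w y * w y' * |S⁻¹ y y'| := hK y y'
    _ ≤ (A * Real.exp (ε * g.dist y y') * g.len y ^ (-(2 : ℝ)) * g.len y' ^ (-(d : ℝ))) *
          ((γ - ρ)⁻¹ * Real.exp (-(κ * g.dist y y'))) :=
        mul_le_mul (hwt y y') hinv (abs_nonneg _) hrhs
    _ = (γ - ρ)⁻¹ * A * g.len y ^ (-(2 : ℝ)) * g.len y' ^ (-(d : ℝ)) *
          (Real.exp (ε * g.dist y y') * Real.exp (-(κ * g.dist y y'))) := by ring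
    _ = (γ - ρ)⁻¹ * A * g.len y ^ (-(2 : ℝ)) * g.len y' ^ (-(d : ℝ)) * Real.exp (-((κ - ε) * g.dist y y')) := by
        rw [exp_growth_mul_decay]

omit [Fintype g.Site] [DecidableEq g.Site] in
/-- **«Of course with different constants»**: the display (3.132) with (C, δ₁) implies it with any C′ ≧ max(C, 0) and δ₁′ ≦ δ₁
(L^jη ≧ 0, d ≧ 0). [cite: Balaban1985BackgroundPropagators, (3.132) p.422 (bookkeeping: monotonicity in the constants)] -/
theorem ineq3132_mono (d : ℕ) {K : B9.SiteKernel g B} {U : B.Cfg} {C C' δ₁ δ₁' : ℝ}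
    (hlen : ∀ y : g.Site, 0 ≤ g.len y) (hdist : ∀ y y' : g.Site, 0 ≤ g.dist y y')
    (h : B9.Ineq3132 d K C δ₁ U) (hC : C ≤ C') (hC' : 0 ≤ C') (hδ : δ₁' ≤ δ₁) : B9.Ineq3132 d K C' δ₁' U := by
  intro y y'
  have hp : 0 ≤ g.len y ^ (-(2 : ℝ)) * g.len y' ^ (-(d : ℝ)) :=
    mul_nonneg (Real.rpow_nonneg (hlen y) _) (Real.rpow_nonneg (hlen y') _)
  have hexp : Real.exp (-(δ₁ * g.dist y y')) ≤ Real.exp (-(δ₁' * g.dist y y')) :=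
    Real.exp_le_exp.mpr (neg_le_neg (mul_le_mul_of_nonneg_right hδ (hdist y y')))
  calc |K.ker U y y'| ≤ C * g.len y ^ (-(2 : ℝ)) * g.len y' ^ (-(d : ℝ)) * Real.exp (-(δ₁ * g.dist y y')) := h y y'
    _ = C * (g.len y ^ (-(2 : ℝ)) * g.len y' ^ (-(d : ℝ))) * Real.exp (-(δ₁ * g.dist y y')) := by ring
    _ ≤ C' * (g.len y ^ (-(2 : ℝ)) * g.len y' ^ (-(d : ℝ))) * Real.exp (-(δ₁' * g.dist y y')) :=
        mul_le_mul (mul_le_mul_of_nonneg_right hC hp) hexp (Real.exp_nonneg _) (mul_nonneg hC' hp)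
    _ = C' * g.len y ^ (-(2 : ℝ)) * g.len y' ^ (-(d : ℝ)) * Real.exp (-(δ₁' * g.dist y y')) := by ring

omit [Fintype g.Site] [DecidableEq g.Site] in
/-- Weighted sums are monotone in the rate: for d ≧ 0 and κ′ ≦ κ, (e^{κ′d} − 1)-weighted absolute sums are below the
(e^{κd} − 1)-weighted ones. [cite: Balaban1984PropagatorsII, Lemma 2.1 (2.61) p.234 (bookkeeping: rate monotonicity of weighted sums)] -/
theorem weighted_term_mono {s t κ κ' : ℝ} (ht : 0 ≤ t) (hκ : κ' ≤ κ) :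
    |s| * (Real.exp (κ' * t) - 1) ≤ |s| * (Real.exp (κ * t) - 1) :=
  mul_le_mul_of_nonneg_left (by linarith [Real.exp_le_exp.mpr (mul_le_mul_of_nonneg_right hκ ht)]) (abs_nonneg s)

omit [Fintype g.Site] [DecidableEq g.Site] in
/-- **THE SYMMETRIC NORMALISATION UN-NORMALISES BY (2.60)**: for the weights w(y) = (L^jη)^{−(1+d∕2)} (so that w(y)w(y′) carries the
total power −(2 + d) split evenly), the scale transfer of [4] (2.60) at rate ε — read as `B6Cor28.TransferL` for the power
q = (d − 2)∕2 with constant A — gives `WeightsTransfer g d w ε A`: w(y)w(y′) = (L^jη)^{−2}(L^{j′}η)^{−d}·((L^{j′}η)∕(L^jη))^{q} ≦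
A e^{εd(y,y′)}(L^jη)^{−2}(L^{j′}η)^{−d}.  (`B6Cor28.transfer_of_260` supplies `TransferL` with A = L^{|q|} from (2.60) and the largeness
L^{|q|} ≦ e^{εRM}.)  So the weights hypothesis of §2 is satisfiable from Lemma 2.1 — recorded for honesty; which normalisation the
instance uses is its own choice. [cite: Balaban1984PropagatorsII, Lemma 2.1 (2.60) p.234; Balaban1985BackgroundPropagators, (3.132) p.422] -/
theorem weightsTransfer_symm_of_260 (d : ℕ) {ε A : ℝ} (hlen : ∀ y : g.Site, 0 < g.len y)
    (hT : TransferL g.len g.dist ε (((d : ℝ) - 2) / 2) A) :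
    WeightsTransfer g d (fun y => g.len y ^ (-(1 + (d : ℝ) / 2))) ε A := by
  intro y y'
  have hy := hlen y
  have hy' := hlen y'
  -- the transfer: ℓ(y′)^q ≤ A e^{εd(y,y′)} ℓ(y)^q, q = (d − 2)/2
  have ht := hT y y'
  -- rewrite both sides as products of real powers
  have e1 : g.len y ^ (-(1 + (d : ℝ) / 2)) = g.len y ^ (-(2 : ℝ)) * g.len y ^ (-(((d : ℝ) - 2) / 2)) := by
    rw [← Real.rpow_add hy]; congr 1; ring
  have e2 : g.len y' ^ (-(1 + (d : ℝ) / 2)) = g.len y' ^ (-(d : ℝ)) * g.len y' ^ (((d : ℝ) - 2) / 2) := by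
    rw [← Real.rpow_add hy']; congr 1; ring
  show g.len y ^ (-(1 + (d : ℝ) / 2)) * g.len y' ^ (-(1 + (d : ℝ) / 2)) ≤ _
  rw [e1, e2]
  have hq : g.len y ^ (-(((d : ℝ) - 2) / 2)) * g.len y' ^ (((d : ℝ) - 2) / 2) ≤ A * Real.exp (ε * g.dist y y') := by
    rw [Real.rpow_neg hy.le, inv_mul_le_iff₀ (Real.rpow_pos_of_pos hy _)]
    calc g.len y' ^ (((d : ℝ) - 2) / 2) ≤ A * Real.exp (ε * g.dist y y') * g.len y ^ (((d : ℝ) - 2) / 2) := ht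
      _ = g.len y ^ (((d : ℝ) - 2) / 2) * (A * Real.exp (ε * g.dist y y')) := by ring
  have hp : 0 ≤ g.len y ^ (-(2 : ℝ)) * g.len y' ^ (-(d : ℝ)) :=
    mul_nonneg (Real.rpow_nonneg hy.le _) (Real.rpow_nonneg hy'.le _)
  calc g.len y ^ (-(2 : ℝ)) * g.len y ^ (-(((d : ℝ) - 2) / 2)) * (g.len y' ^ (-(d : ℝ)) * g.len y' ^ (((d : ℝ) - 2) / 2))
      = (g.len y ^ (-(2 : ℝ)) * g.len y' ^ (-(d : ℝ))) *
          (g.len y ^ (-(((d : ℝ) - 2) / 2)) * g.len y' ^ (((d : ℝ) - 2) / 2)) := by ring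
    _ ≤ (g.len y ^ (-(2 : ℝ)) * g.len y' ^ (-(d : ℝ))) * (A * Real.exp (ε * g.dist y y')) :=
        mul_le_mul_of_nonneg_left hq hp
    _ = A * Real.exp (ε * g.dist y y') * g.len y ^ (-(2 : ℝ)) * g.len y' ^ (-(d : ℝ)) := by ring

end OneU

/-! ## §3 The whole printed leaf -/

section Family

variable {I : Type} {c35 : ℝ} {geo : I → B9.Geometry} {bg : I → B9.Backgrounds}
  [∀ i, Fintype (geo i).Site] [∀ i, DecidableEq (geo i).Site]

/-- ★ **(3.132) AS THE WHOLE PRINTED LEAF `B9.Stmt3132Printed`** (p. 422: *"We have |(QGQ\*)^{−1}(y, y′)| ≤ O(1)(L^jη)^{−2}(L^{j′}η)^{−d}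
e^{−δ₁d(y,y′)} … (3.132) and the same for the operator with G₁ instead of G"*, under the prefix of Theorem 3.12), INHABITED from: the
Combes–Thomas inputs `CTInputs` for the normalised matrices `S` of QGQ\* and `S₁` of QG₁Q\* (II.a coercivity + II.b weighted sums, each
under the printed thresholds), the un-normalising dictionaries `InvNormalised` for the two kernels, the weights transfer at EVERY
rate under an M-threshold with ONE constant A > 0 for both weight families (what [4] (2.60) gives for a common L,
`weightsTransfer_symm_of_260`), and the pseudo-metric ∕ sign facts of the carrier (d symmetric, zero diagonal, (2.54), hence d ≧ 0;
L^jη ≧ 0).  Mechanism: `QGQInverse.inverse_decay` at the common rate κ₀ := min κ κ′ (weighted sums are rate-monotone), transfer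
at ε := ½κ₀.  The printed quantifiers are met with M₄″ := max(max M₄ M₄′, M_w), a₀″ := min a₀ a₀′, δ₁ := ½κ₀ and
O(1) := ((γ − ρ)⁻¹ + (γ′ − ρ′)⁻¹)·A — explicit.  Nothing of print asserted (all inputs are hypotheses); NOT a node discharge.
[cite: Balaban1985BackgroundPropagators, (3.132) p.422 + Thm 3.12 p.423 (prefix); Balaban1984PropagatorsII, Lemma 2.1 (2.60)–(2.61) p.234] -/
theorem stmt3132Printed_of_coercive (d : ℕ) {QGQinv QG₁Qinv : ∀ i, B9.SiteKernel (geo i) (bg i)}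
    {S S₁ : ∀ i, (bg i).Cfg → Matrix (geo i).Site (geo i).Site ℝ} {w w₁ : ∀ i, (geo i).Site → ℝ}
    (hCT : CTInputs c35 geo bg S) (hCT₁ : CTInputs c35 geo bg S₁)
    (hN : ∀ i, InvNormalised (QGQinv i) (S i) (w i)) (hN₁ : ∀ i, InvNormalised (QG₁Qinv i) (S₁ i) (w₁ i))
    (hsymm : ∀ i (y y' : (geo i).Site), (geo i).dist y y' = (geo i).dist y' y)
    (hzero : ∀ i (y : (geo i).Site), (geo i).dist y y = 0)
    (htri : ∀ i (a b c : (geo i).Site), (geo i).dist a c ≤ (geo i).dist a b + (geo i).dist b c)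
    (hlen : ∀ i (y : (geo i).Site), 0 ≤ (geo i).len y) {A : ℝ} (hA : 0 < A)
    (hwt : ∀ ε : ℝ, 0 < ε → ∃ Mw : ℝ, ∀ i : I, Mw ≤ (geo i).M →
      WeightsTransfer (geo i) d (w i) ε A ∧ WeightsTransfer (geo i) d (w₁ i) ε A) :
    B9.Stmt3132Printed d c35 geo bg QGQinv QG₁Qinv := by
  obtain ⟨M₄, a₀, γ, ρ, κ, hM₄, ha₀, hργ, hκ, H⟩ := hCT
  obtain ⟨M₄', a₀', γ', ρ', κ', hM₄', ha₀', hργ', hκ', H'⟩ := hCT₁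
  -- d ≥ 0 from the pseudo-metric axioms
  have hdist : ∀ i (y y' : (geo i).Site), 0 ≤ (geo i).dist y y' := by
    intro i y y'
    have h := htri i y y' y
    rw [hzero i, hsymm i y' y] at h
    linarith
  -- common rate and transfer rate
  set κ₀ : ℝ := min κ κ' with hκ₀
  have hκ₀pos : 0 < κ₀ := lt_min hκ hκ'
  obtain ⟨Mw, Hw⟩ := hwt (κ₀ / 2) (by positivity)
  have hC : 0 ≤ (γ - ρ)⁻¹ := inv_nonneg.mpr (by linarith)
  have hC' : 0 ≤ (γ' - ρ')⁻¹ := inv_nonneg.mpr (by linarith)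
  refine ⟨max (max M₄ M₄') Mw, κ₀ / 2, min a₀ a₀', ((γ - ρ)⁻¹ + (γ' - ρ')⁻¹) * A,
    lt_max_of_lt_left (lt_max_of_lt_left hM₄), by positivity, lt_min ha₀ ha₀', ?_, ?_⟩
  · have h1 : 0 < (γ - ρ)⁻¹ := inv_pos.mpr (by linarith)
    positivity
  · intro i hM α₀ hα₀ hMa U hU hU'
    have hM₄i : M₄ ≤ (geo i).M := le_trans (le_trans (le_max_left _ _) (le_max_left _ _)) hM
    have hM₄i' : M₄' ≤ (geo i).M := le_trans (le_trans (le_max_right _ _) (le_max_left _ _)) hM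
    have hMwi : Mw ≤ (geo i).M := le_trans (le_max_right _ _) hM
    obtain ⟨hco, hrow, hcol⟩ := H i hM₄i α₀ hα₀ (le_trans hMa (min_le_left _ _)) U hU hU'
    obtain ⟨hco', hrow', hcol'⟩ := H' i hM₄i' α₀ hα₀ (le_trans hMa (min_le_right _ _)) U hU hU'
    obtain ⟨hwtS, hwtS₁⟩ := Hw i hMwi
    -- weighted sums at the common rate κ₀
    have hrow₀ : ∀ y, ∑ y', |S i U y y'| * (Real.exp (κ₀ * (geo i).dist y y') - 1) ≤ ρ := fun y =>
      le_trans (Finset.sum_le_sum fun y' _ => weighted_term_mono (hdist i y y') (min_le_left _ _)) (hrow y)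
    have hcol₀ : ∀ y', ∑ y, |S i U y y'| * (Real.exp (κ₀ * (geo i).dist y y') - 1) ≤ ρ := fun y' =>
      le_trans (Finset.sum_le_sum fun y _ => weighted_term_mono (hdist i y y') (min_le_left _ _)) (hcol y')
    have hrow₀' : ∀ y, ∑ y', |S₁ i U y y'| * (Real.exp (κ₀ * (geo i).dist y y') - 1) ≤ ρ' := fun y =>
      le_trans (Finset.sum_le_sum fun y' _ => weighted_term_mono (hdist i y y') (min_le_right _ _)) (hrow' y)
    have hcol₀' : ∀ y', ∑ y, |S₁ i U y y'| * (Real.exp (κ₀ * (geo i).dist y y') - 1) ≤ ρ' := fun y' =>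
      le_trans (Finset.sum_le_sum fun y _ => weighted_term_mono (hdist i y y') (min_le_right _ _)) (hcol' y')
    -- the two displays at rate κ₀ − κ₀/2 = κ₀/2
    have e : κ₀ - κ₀ / 2 = κ₀ / 2 := by ring
    have h1 := ineq3132_of_coercive d (QGQinv i) U (S i U) (w i) hργ hκ₀pos.le hA.le hco (hsymm i) (hzero i) (htri i)
      (hlen i) hrow₀ hcol₀ (hN i U) hwtS
    have h2 := ineq3132_of_coercive d (QG₁Qinv i) U (S₁ i U) (w₁ i) hργ' hκ₀pos.le hA.le hco' (hsymm i) (hzero i)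
      (htri i) (hlen i) hrow₀' hcol₀' (hN₁ i U) hwtS₁
    rw [e] at h1 h2
    have hsum : 0 ≤ ((γ - ρ)⁻¹ + (γ' - ρ')⁻¹) * A := mul_nonneg (add_nonneg hC hC') hA.le
    exact ⟨ineq3132_mono d (hlen i) (hdist i) h1
        (mul_le_mul_of_nonneg_right (le_add_of_nonneg_right hC') hA.le) hsum le_rfl,
      ineq3132_mono d (hlen i) (hdist i) h2
        (mul_le_mul_of_nonneg_right (le_add_of_nonneg_left hC) hA.le) hsum le_rfl⟩

end Family

end

end Literature.MathematicalPhysics.QuantumFieldTheory.Balaban1983to89.B9Eq3132Whole
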